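import Summits.QuantumFields.YangMills.Theorems.BalabanUVNodesN15KingModelPaleyWienerLine

/-!
# BalabanUVNodes ∕ N15 — THE KING-MODEL RUNG (PART Ϸ-c): THE OPTIMAL EXPONENTIAL DECAY RATE OF THE CONTINUUM TWO-POINT FUNCTION —
# `|S₂^{ℝ}(z)| ≤ K_d(c,m)·e^{−c|z_ν|}` for EVERY `0 < c < m` and every coordinate `ν` (the free block field clusters at every rate below its mass)
# (Track A, DAG node N15 = NE2; FAN-OUT v1.1 §N15 s3 «KING-MODEL RUNG»; uses parts Ϝ-j (`kingS2Inf`, `twoPtIntegrand`), Ϸ-a∕Ϸ-b (the one-line Paley–Wiener bound);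
# count-neutral)

HONEST FRAMING.  Count-neutral (cell `pub-ymgap`, seat `pub-ymgap-dag-n15-e` g34; `--supports stmt-QuantumFields-27366 --as helper` = K3⁸
`SpineGivenEndpointR13SepCoPHV`).  King's `A = 0`, `g = 0` model ([King1986] C. King, Commun. Math. Phys. **102** (1986) 649–677): part Ϝ-j's thermodynamic limit of
the block-smeared Schwinger two-point function, `S₂^{ℝ}(z) = (2π)^{−n}∫_{ℝⁿ}Π_μ sinc²(p_μ∕2)·cos(p·z)∕(|p|²+m²)dp` (`n = d+1`), was shown in part Ϝ-k to cluster with the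
Combes–Thomas rate `κ_M` inherited from the lattice (`|S₂^{ℝ}(z)| ≤ (2∕γ_m)e^{−κ_M|z_ν|}`, `κ_M < m`).  THIS FILE proves the OPTIMAL statement — Thm 3.3 (3.6)'s shape
with the true correlation length: for EVERY `0 < c < m`, `|S₂^{ℝ}(z)| ≤ K_d(c,m)·e^{−c|z_ν|}` with
`K_d(c,m) = (2π)^{−(d+1)}·2π(1+cosh c)∕(c(m²−c²))·((17+16π²)π)^d`.  PROOF: split `ℝ^{d+1} = ℝ_ν × ℝ^d` (Mathlib `MeasurableEquiv.piFinSuccAbove`, volume-preserving),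
Fubini with `p_⊥` outside; the inner `p_ν`-integral is part Ϸ-b's one-line Fourier integral of `sinc²(p_ν∕2)∕(p_ν² + M²)`, `M² = m² + |p_⊥|²`, with phase `θ = p_⊥·z_⊥`,
bounded by `2π(1+cosh c)∕(c(m²−c²))·e^{−c|z_ν|}` UNIFORMLY in `p_⊥` (Paley–Wiener shift to `Im p_ν = ±c`, poles at `±iM`, `M ≥ m`); the outer integral of the remaining
`Π_{μ≠ν}sinc²(p_μ∕2)` is at most `((17+16π²)π)^d` (part Ϝ-j's window).  The rate cannot exceed `m` (the momentum-space integrand has poles at `|Im p_ν| = M ≥ m`, with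
equality on `p_⊥ = 0`), so `c < m` arbitrary is optimal up to the prefactor.  NOT a node discharge (N15 is booked through n15-a's knit, untouched here); nothing Bałaban ∕
continuum-Yang–Mills ∕ `ℝ⁴` ∕ OS ∕ Clay — the «mass» is the free field's `m`, NOT a Yang–Mills mass gap.  0 `sorry`, 0 def; standard axioms.

WHAT THIS FILE PROVES (kernel).  `twoPtIntegrand_eq_prod` (the integrand in sinc form), `abs_twoPtIntegrand_le_prod_window`, ★ `integrable_twoPtIntegrand`, `integral_prod_sinc_window`
(`∫Π(17+16π²)(1+q_j²)⁻¹ = ((17+16π²)π)^d`), `twoPtIntegrand_insertNth` (the split integrand at `p = insertNth ν x q`), ★ `abs_inner_integral_le` (the one-line bound at fixed `p_⊥`),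
★★★ **`abs_kingS2Inf_le_exp_of_sq_lt`** (THE OPTIMAL DECAY: every `0 < c`, `c² < m²`, every `z`, every `ν`).

HONEST SCOPE.  King's free model; the prefactor `K_d(c,m)` blows up as `c → m` and as `c → 0` and is not optimised; no statement about `z = 0` beyond the bound itself.  N15 untouched;
counts unmoved.  Locators (use): [King1986] Thm 2.1 (2.22) p.654, Thm 3.3 (3.6) p.655, (4.5) p.670, Lemma 4.5 (4.38) p.675.
-/

noncomputable section

open scoped BigOperators Topology
open Complex Filter MeasureTheory

namespace Summit.QuantumFields.YangMills.BalabanUVNodes.N15KingModelRung.OptimalDecay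

open Literature.MathematicalPhysics.QuantumFieldTheory.King1986 (momSq)

variable {d : ℕ}

/-! ## §1 The integrand in sinc form, its integrability, and the window integral -/

/-- The integrand of `S₂^{ℝ}` in sinc form: `h_z(p) = (Π_μ sinc²(p_μ∕2))∕(Σ_μ p_μ² + m²)·cos(Σ_μ p_μ z_μ)`. [cite: King1986, (4.5) p.670, (4.36) p.674] -/
theorem twoPtIntegrand_eq_prod (m2 : ℝ) (z : Fin (d + 1) → ℤ) (p : Fin (d + 1) → ℝ) :
    twoPtIntegrand m2 z p = (∏ μ, Real.sinc (p μ / 2) ^ 2) / ((∑ μ, p μ ^ 2) + m2) * Real.cos (∑ μ, p μ * z μ) := by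
  unfold twoPtIntegrand momSq
  rw [norm_uWeight0, ← Finset.prod_pow]
  congr 2
  exact Finset.prod_congr rfl fun μ _ => norm_sq_uFac0_eq_sinc_sq (p μ)

/-- The product-window majorant: `|h_z(p)| ≤ m⁻²·Π_μ (17+16π²)(1+p_μ²)⁻¹`. [folklore] -/
theorem abs_twoPtIntegrand_le_prod_window {m2 : ℝ} (hm : 0 < m2) (z : Fin (d + 1) → ℤ) (p : Fin (d + 1) → ℝ) :
    |twoPtIntegrand m2 z p| ≤ m2⁻¹ * ∏ μ, ((17 + 16 * Real.pi ^ 2) * (1 + p μ ^ 2)⁻¹) := by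
  refine (abs_twoPtIntegrand_le hm z p).trans (mul_le_mul_of_nonneg_left ?_ (inv_nonneg.mpr hm.le))
  exact Finset.prod_le_prod (fun μ _ => sq_nonneg _) fun μ _ => sinc_sq_half_window (s := p μ) (t := p μ) (by simp; positivity)

/-- ★ The integrand of `S₂^{ℝ}` is integrable over `ℝ^{d+1}`. [cite: King1986, (4.5) p.670] -/
theorem integrable_twoPtIntegrand {m2 : ℝ} (hm : 0 < m2) (z : Fin (d + 1) → ℤ) : Integrable (twoPtIntegrand m2 z) := by
  have hprod : Integrable (fun p : Fin (d + 1) → ℝ => ∏ μ, ((17 + 16 * Real.pi ^ 2) * (1 + p μ ^ 2)⁻¹)) :=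
    Integrable.fintype_prod (f := fun (_ : Fin (d + 1)) (x : ℝ) => (17 + 16 * Real.pi ^ 2) * (1 + x ^ 2)⁻¹)
      fun _ => integrable_inv_one_add_sq.const_mul _
  refine (hprod.const_mul m2⁻¹).mono' (continuous_twoPtIntegrand hm z).aestronglyMeasurable (Eventually.of_forall fun p => ?_)
  rw [Real.norm_eq_abs]
  exact abs_twoPtIntegrand_le_prod_window hm z p

/-- The window integral: `∫_{ℝ^d}Π_j (17+16π²)(1+q_j²)⁻¹dq = ((17+16π²)π)^d`. [folklore] -/
theorem integral_prod_sinc_window (d : ℕ) :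
    ∫ q : Fin d → ℝ, ∏ j, ((17 + 16 * Real.pi ^ 2) * (1 + q j ^ 2)⁻¹) = ((17 + 16 * Real.pi ^ 2) * Real.pi) ^ d := by
  rw [integral_fintype_prod_volume_eq_pow (fun x : ℝ => (17 + 16 * Real.pi ^ 2) * (1 + x ^ 2)⁻¹), integral_const_mul, integral_univ_inv_one_add_sq,
    Fintype.card_fin]

/-! ## §2 The split at the coordinate `ν` and the one-line bound at fixed `p_⊥` -/

/-- The integrand at `p = insertNth ν x q`: `h_z = sinc²(x∕2)·P(q)∕(x² + (|q|² + m²))·cos(x z_ν + θ(q))`, `P(q) = Π_j sinc²(q_j∕2)`, `θ(q) = Σ_j q_j z_{ν↑j}`.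
[cite: King1986, (4.5) p.670] -/
theorem twoPtIntegrand_insertNth (m2 : ℝ) (z : Fin (d + 1) → ℤ) (ν : Fin (d + 1)) (x : ℝ) (q : Fin d → ℝ) :
    twoPtIntegrand m2 z (Fin.insertNth ν x q)
      = (∏ j, Real.sinc (q j / 2) ^ 2)
          * (Real.sinc (x / 2) ^ 2 / (x ^ 2 + ((∑ j, q j ^ 2) + m2)) * Real.cos (x * z ν + ∑ j, q j * z (ν.succAbove j))) := by
  rw [twoPtIntegrand_eq_prod]
  simp only [Fin.prod_univ_succAbove _ ν, Fin.sum_univ_succAbove _ ν, Fin.insertNth_apply_same, Fin.insertNth_apply_succAbove]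
  rw [show x ^ 2 + ∑ j, q j ^ 2 + m2 = x ^ 2 + ((∑ j, q j ^ 2) + m2) by ring]
  ring

/-- ★ **THE ONE-LINE BOUND AT FIXED `p_⊥`**: for `0 < c`, `c² < m²`, every `q ∈ ℝ^d`,
`|∫ h_z(insertNth ν x q)dx| ≤ P(q)·2π(1+cosh c)∕(c(m²−c²))·e^{−c|z_ν|}` (part Ϸ-b with `M² = |q|² + m² ≥ m²`, `θ = q·z_⊥`). [folklore] -/
theorem abs_inner_integral_le {m2 c : ℝ} (hm : 0 < m2) (hc0 : 0 < c) (hc : c ^ 2 < m2) (z : Fin (d + 1) → ℤ) (ν : Fin (d + 1)) (q : Fin d → ℝ) :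
    |∫ x : ℝ, twoPtIntegrand m2 z (Fin.insertNth ν x q)|
      ≤ (∏ j, Real.sinc (q j / 2) ^ 2) * (2 * Real.pi * (1 + Real.cosh c) / (c * (m2 - c ^ 2)) * Real.exp (-(c * |(z ν : ℝ)|))) := by
  simp_rw [twoPtIntegrand_insertNth]
  rw [integral_const_mul, abs_mul, abs_of_nonneg (Finset.prod_nonneg fun j _ => sq_nonneg _)]
  refine mul_le_mul_of_nonneg_left ?_ (Finset.prod_nonneg fun j _ => sq_nonneg _)
  have hM : m2 ≤ (∑ j, q j ^ 2) + m2 := le_add_of_nonneg_left (Finset.sum_nonneg fun j _ => sq_nonneg _)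
  exact abs_integral_sinc_sq_cos_div_le hm hM hc0 hc (z ν : ℝ) (∑ j, q j * z (ν.succAbove j))

/-! ## §3 The optimal decay -/

/-- ★★★ **THE OPTIMAL EXPONENTIAL DECAY RATE OF THE CONTINUUM TWO-POINT FUNCTION**: for every `0 < c` with `c² < m²`, every separation `z ∈ ℤ^{d+1}` and every
coordinate `ν`, `|S₂^{ℝ}(z)| ≤ (2π)^{−(d+1)}·2π(1+cosh c)∕(c(m²−c²))·((17+16π²)π)^d·e^{−c|z_ν|}` — the free block field clusters at EVERY rate below its mass `m`
(Thm 3.3 (3.6)'s shape with the true correlation length; Paley–Wiener in the `ν`-th momentum, Fubini over the others).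
[cite: King1986, Thm 3.3 (3.6) p.655, Thm 2.1 (2.22) p.654, Lemma 4.5 (4.38) p.675] -/
theorem abs_kingS2Inf_le_exp_of_sq_lt {m2 c : ℝ} (hm : 0 < m2) (hc0 : 0 < c) (hc : c ^ 2 < m2) (z : Fin (d + 1) → ℤ) (ν : Fin (d + 1)) :
    |kingS2Inf m2 z|
      ≤ ((2 * Real.pi) ^ (d + 1))⁻¹ * (2 * Real.pi * (1 + Real.cosh c) / (c * (m2 - c ^ 2))) * ((17 + 16 * Real.pi ^ 2) * Real.pi) ^ d
          * Real.exp (-(c * |(z ν : ℝ)|)) := by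
  -- the split `ℝ^{d+1} ≃ ℝ × ℝ^d` at `ν`, volume-preserving
  set e := MeasurableEquiv.piFinSuccAbove (fun _ : Fin (d + 1) => ℝ) ν with he
  have hemp : MeasurePreserving e volume volume := volume_preserving_piFinSuccAbove (fun _ : Fin (d + 1) => ℝ) ν
  have hsymm : MeasurePreserving e.symm volume volume := hemp.symm e
  set F : (Fin (d + 1) → ℝ) → ℝ := twoPtIntegrand m2 z with hF
  have hFint : Integrable F := integrable_twoPtIntegrand hm z
  -- `∫ F = ∫_{ℝ × ℝ^d} F ∘ e.symm`
  have h1 : ∫ p, F p = ∫ y : ℝ × (Fin d → ℝ), F (e.symm y) := (hsymm.integral_comp' F).symm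
  have hGint : Integrable (fun y : ℝ × (Fin d → ℝ) => F (e.symm y)) := (hsymm.integrable_comp_emb e.symm.measurableEmbedding).mpr hFint
  have hsymm_apply : ∀ (x : ℝ) (q : Fin d → ℝ), e.symm (x, q) = Fin.insertNth ν x q := fun x q => by
    rw [he, MeasurableEquiv.piFinSuccAbove_symm_apply]
    rfl
  -- Fubini with `p_⊥` outside
  have h2 : ∫ y : ℝ × (Fin d → ℝ), F (e.symm y) = ∫ q : Fin d → ℝ, ∫ x : ℝ, F (e.symm (x, q)) := by
    rw [Measure.volume_eq_prod] at hGint ⊢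
    exact integral_prod_symm _ hGint
  -- the pointwise bound on the inner integrals
  set K : ℝ := 2 * Real.pi * (1 + Real.cosh c) / (c * (m2 - c ^ 2)) * Real.exp (-(c * |(z ν : ℝ)|)) with hK
  have hK0 : 0 ≤ K := by
    have : 0 < m2 - c ^ 2 := by linarith
    positivity
  have hinner : ∀ q : Fin d → ℝ, ‖∫ x : ℝ, F (e.symm (x, q))‖ ≤ K * ∏ j, ((17 + 16 * Real.pi ^ 2) * (1 + q j ^ 2)⁻¹) := by
    intro q
    simp_rw [hsymm_apply]
    rw [Real.norm_eq_abs]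
    refine (abs_inner_integral_le hm hc0 hc z ν q).trans ?_
    rw [mul_comm]
    refine mul_le_mul_of_nonneg_left ?_ hK0
    exact Finset.prod_le_prod (fun j _ => sq_nonneg _) fun j _ => sinc_sq_half_window (s := q j) (t := q j) (by simp; positivity)
  have hwin : Integrable (fun q : Fin d → ℝ => K * ∏ j, ((17 + 16 * Real.pi ^ 2) * (1 + q j ^ 2)⁻¹)) :=
    (Integrable.fintype_prod (f := fun (_ : Fin d) (x : ℝ) => (17 + 16 * Real.pi ^ 2) * (1 + x ^ 2)⁻¹)
      fun _ => integrable_inv_one_add_sq.const_mul _).const_mul K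
  have h3 : |∫ q : Fin d → ℝ, ∫ x : ℝ, F (e.symm (x, q))| ≤ K * ((17 + 16 * Real.pi ^ 2) * Real.pi) ^ d := by
    rw [← Real.norm_eq_abs]
    refine (norm_integral_le_of_norm_le hwin (Eventually.of_forall hinner)).trans (le_of_eq ?_)
    rw [integral_const_mul, integral_prod_sinc_window]
  -- assemble
  unfold kingS2Inf
  rw [abs_mul, abs_of_pos (by positivity), ← hF, h1, h2]
  calc ((2 * Real.pi) ^ (d + 1))⁻¹ * |∫ q : Fin d → ℝ, ∫ x : ℝ, F (e.symm (x, q))|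
      ≤ ((2 * Real.pi) ^ (d + 1))⁻¹ * (K * ((17 + 16 * Real.pi ^ 2) * Real.pi) ^ d) := mul_le_mul_of_nonneg_left h3 (by positivity)
    _ = _ := by rw [hK]; ring

end Summit.QuantumFields.YangMills.BalabanUVNodes.N15KingModelRung.OptimalDecay
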